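import Summits.QuantumFields.YangMills.Theorems.BalabanUVNodesN21HistoriesModelAEndToEnd

/-!
# YM-DAG node N21 (= NE7c) — HEREDITARY SHADOWS GIVE CAUSAL LIVENESS AND THE GEOMETRY: module 20i's two NODE-O binders `hcausal` (the liveness rule reads only older
# labels) and `hgeom` (the neighbourhood N16 reads at a live-small window slot lies inside the history's live-small region) are THEOREMS for the print-shaped rule
# «a slot is live iff every slot of its SHADOW is labelled small», whenever the shadows are OLDER and HEREDITARY and N16's neighbourhoods lie inside them

Track A of `YM-PLAN.md` (cell `pub-ymgap`, HUMAN RULING D-0062), node **N21**; R134 fan-out seat `pub-ymgap-dag-n21-d` (s2), generation 6, module 20j.  THEOREMS ONLY: 0 `def`,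
0 `sorry`, standard axioms; COUNT-NEUTRAL; KEY-FREE; `--supports` the K3⁗ item `SpineGivenEndpointR13Sep` (stmt-QuantumFields-20292) as a helper.  NO Theses import, NO
`Node00.Record13` import.  Imports module 20i `BalabanUVNodesN21HistoriesModelAEndToEnd` v1.1 (`shellWeightBound_histories_modelAW_window` — N16's `hdet` at the window slots only; brings 20h `liveSmall` ∕ `liveSmallW`).

THE POINT.  In print ([Balaban1988Convergent] (1.4) ∕ (1.8): the new small-field region is carved out of the complement of the enlarged older large-field regions) a slot
of the two-run bookkeeping is LIVE exactly when no OLDER slot in its spatial SHADOW carries a large-field label.  Abstractly: a shadow map `shadow : Fin n → Finset (Fin n)`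
and the rule `live τ s = true ↔ ∀ c ∈ shadow s, τ c = true`.  If shadows are OLDER (`c ∈ shadow s → c < s`) the rule is CAUSAL (20i's `hcausal`); if they are HEREDITARY
(`c ∈ shadow s → shadow c ⊆ shadow s`) then every slot of the shadow of a live slot is itself live, so for a live-small slot `s` the whole shadow is live-small, and any
neighbourhood `nbhd s ⊆ shadow s` satisfies 20i's `hgeom` — for EVERY window `W`.  §2 restates 20i's end-to-end theorem with `hcausal`, `hgeom` REPLACED by these three
finitary conditions on NODE O's slot data (`liveness_iff_shadow`, `shadow_lt`, `shadow_hereditary`, `nbhd_subset_shadow`).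

HONEST FRAMING (binding).  [folklore] finite combinatorics on the cell's typed letters; a MODEL family (whether print's regions realise hereditary shadows slot-wise is NODE O's
to certify on its typed object); nothing of Bałaban's asserted; (M1) at FIXED thresholds untouched; NE7c is NOT PRINTED and NOT PROVED; **N21 is NOT discharged**; K3⁗ NOT claimed;
typed 28∕28, discharged count untouched; one finite four-torus programme at fixed `ε` — NOT ℝ⁴, NOT infinite volume, NOT OS, NOT a mass gap, NOT Clay.  No decl carries a cite tag.
-/

set_option autoImplicit false

noncomputable section

open scoped BigOperators ENNReal
open MeasureTheory Set

namespace Summit.QuantumFields.YangMills.Theorems.N21HistoriesShadowLiveness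

open Literature.MathematicalPhysics.QuantumFieldTheory.Balaban1983to89
open Literature.MathematicalPhysics.QuantumFieldTheory.Balaban1983to89.T4Continuum (T4Family ULoop FiniteEpsData)
open Literature.MathematicalPhysics.QuantumFieldTheory.Balaban1983to89.T4IndicatorShell (ShellWeightBound)
open T4GenFunBounds (prodObs)
open T4ShellMeasureLevels (LiveWindow)
open Summit.QuantumFields.BalabanUV.T4Continuum.ShellMeasureRootCompositionHistories (histWeight histShell)
open Summit.QuantumFields.YangMills.Theorems.N21HistoriesModelADefs (liveSmall)
open Summit.QuantumFields.YangMills.Theorems.N21HistoriesWindowedModelADefs (liveSmallW modelAWeightW)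
open Summit.QuantumFields.YangMills.Theorems.N21HistoriesModelAEndToEnd (shellWeightBound_histories_modelAW_window ext_injective)

/-! ## §1 the shadow rule: causal, and hereditary shadows of live slots are live-small -/

section Shadow

variable {n : ℕ} (live : (Fin n → Bool) → Fin n → Bool) (shadow : Fin n → Finset (Fin n))
  (hlive : ∀ τ s, live τ s = true ↔ ∀ c ∈ shadow s, τ c = true)

include hlive

/-- **OLDER SHADOWS MAKE THE RULE CAUSAL** (module 20i's `hcausal`): if `c ∈ shadow s → c < s`, the liveness of `s` reads only the labels older than `s`. [folklore] -/
theorem live_causal_of_shadow (hlt : ∀ s, ∀ c ∈ shadow s, c < s) (τ τ' : Fin n → Bool) (s : Fin n) (h : ∀ j, j < s → τ j = τ' j) :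
    live τ s = live τ' s := by
  rcases Bool.eq_false_or_eq_true (live τ' s) with h' | h'
  · rw [h', hlive]
    exact fun c hc => (h c (hlt s c hc)) ▸ (hlive τ' s).1 h' c hc
  · rw [h', Bool.eq_false_iff, ne_eq, hlive]
    intro hall
    exact (Bool.eq_false_iff.1 h') ((hlive τ' s).2 fun c hc => (h c (hlt s c hc)).symm ▸ hall c hc)

/-- **HEREDITARY SHADOWS OF A LIVE SLOT ARE LIVE-SMALL**: if `c ∈ shadow s → shadow c ⊆ shadow s` and `s` is live, then every `c ∈ shadow s` is live (its shadow lies in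
`s`'s, all of whose labels are small) and small — `shadow s ⊆ liveSmall live τ`. [folklore] -/
theorem shadow_subset_liveSmall (hher : ∀ s, ∀ c ∈ shadow s, shadow c ⊆ shadow s) (τ : Fin n → Bool) (s : Fin n) (hs : live τ s = true) :
    shadow s ⊆ liveSmall live τ := by
  intro c hc
  have hsmall := (hlive τ s).1 hs
  simp only [liveSmall, Finset.mem_filter, Finset.mem_univ, true_and]
  exact ⟨(hlive τ c).2 fun c' hc' => hsmall c' (hher s c hc hc'), hsmall c hc⟩

/-- **… HENCE MODULE 20i's GEOMETRY `hgeom` FOR ANY NEIGHBOURHOODS INSIDE THE SHADOWS AND ANY WINDOW**: for a live-small window slot `s`, `nbhd s ⊆ liveSmall live τ`. [folklore] -/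
theorem nbhd_subset_liveSmall (hher : ∀ s, ∀ c ∈ shadow s, shadow c ⊆ shadow s) (nbhd : Fin n → Finset (Fin n)) (hnb : ∀ s, nbhd s ⊆ shadow s)
    (W : Finset (Fin n)) (τ : Fin n → Bool) (s : Fin n) (hs : s ∈ liveSmallW W live τ) : nbhd s ⊆ liveSmall live τ := by
  have hl : live τ s = true := by
    simp only [liveSmallW, Finset.mem_filter, Finset.mem_univ, true_and] at hs
    exact hs.1.1
  exact (hnb s).trans (shadow_subset_liveSmall live shadow hlive hher τ s hl)

end Shadow

/-! ## §2 module 20i's end-to-end theorem with `hcausal`, `hgeom` discharged by the shadow rule -/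

section EndToEnd

variable {F : T4Family} {G : Type*} [GaugeGroup G] [MeasurableSpace G] [HaarData G] [RegularGaugeGroup G]
  (D : FiniteEpsData F G) (g₀ : ℕ → ℝ) (os : List (ULoop F)) (K₀ : ℕ)
  {Ω : ℕ → Type*} [∀ K, MeasurableSpace (Ω K)]
  (n : ℕ → ℕ) (W : ∀ K : ℕ, Finset (Fin (n K))) (live : ∀ K : ℕ, (Fin (n K) → Bool) → Fin (n K) → Bool)
  (shadow nbhd : ∀ K : ℕ, Fin (n K) → Finset (Fin (n K)))
  (lvl : ℕ → ℕ → ℕ) (uA uB : ∀ K : ℕ, ℕ → Ω K → ℝ)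
  {Γ0A Γ0B : ∀ K : ℕ, Measure (Ω K)} [∀ K, IsFiniteMeasure (Γ0A K)] [∀ K, IsFiniteMeasure (Γ0B K)]
  {πA : ∀ K : ℕ, Ω K → GaugeField ((D.scheme g₀).P (K₀ + K)) 0 G} {πB : ∀ K : ℕ, Ω K → GaugeField ((D.scheme g₀).P (K₀ + K + 1)) 0 G}
  {θ κ ρ Δ : ℕ → ℝ} {l₀ νbar : ℝ} {N₁ : ℕ} {κmin c₁ ϑ : ℝ}

/-- **N21's ROAD I FOR THE WINDOWED MODEL-A FAMILY AT THE RECORD WITH THE SHADOW LIVENESS RULE** — module 20i's `shellWeightBound_histories_modelAW` with `hcausal` and `hgeom`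
REPLACED (in its v1.1 window form) by: the rule `live K τ s ↔ ∀ c ∈ shadow K s, τ c` (`hlive`), OLDER shadows (`hlt`), HEREDITARY shadows (`hher`), and N16's neighbourhoods inside the shadows (`hnb`).
Everything else (N16's pointwise `hdet`, N20's window, the box, the rate, the t-free laws and projections, `AvgMeasurable`) as in 20i.  A MODEL family; CONDITIONAL; NE7c NOT proved;
N21 NOT discharged. [folklore] -/
theorem shellWeightBound_histories_modelAW_shadow (hM : D.AvgMeasurable) (hπA : ∀ K, Measurable (πA K)) (hπB : ∀ K, Measurable (πB K))
    (huA : ∀ K j, Measurable (uA K j)) (huB : ∀ K j, Measurable (uB K j))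
    (hlive : ∀ K (τ : Fin (n K) → Bool) (s : Fin (n K)), live K τ s = true ↔ ∀ c ∈ shadow K s, τ c = true)
    (hlt : ∀ K (s : Fin (n K)), ∀ c ∈ shadow K s, c < s) (hher : ∀ K (s : Fin (n K)), ∀ c ∈ shadow K s, shadow K c ⊆ shadow K s)
    (hnb : ∀ K (s : Fin (n K)), nbhd K s ⊆ shadow K s)
    (hdetA : ∀ K (s : Fin (n K)), s ∈ W K → ∀ ω : Ω K, (∀ c ∈ nbhd K s, uA K c.1 ω < θ (lvl K c.1)) → |uA K s.1 ω - uB K s.1 ω| ≤ Δ (lvl K s.1))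
    (hdetB : ∀ K (s : Fin (n K)), s ∈ W K → ∀ ω : Ω K, (∀ c ∈ nbhd K s, uB K c.1 ω < θ (lvl K c.1)) → |uB K s.1 ω - uA K s.1 ω| ≤ Δ (lvl K s.1))
    (hθ : ∀ j, 0 < θ j) (hκ : ∀ j, 0 < κ j ∧ κ j ≤ 1) (hρ : ∀ j, 0 ≤ ρ j ∧ ρ j < 1)
    (hwin : LiveWindow (fun K => (W K).map Fin.valEmbedding) lvl N₁ νbar)
    (hΔ : ∀ j, Δ j ≤ ρ j * ((1 - κ j) * θ j))
    (hκmin : 0 < κmin) (hκminle : ∀ j, κmin ≤ κ j) (hρhalf : ∀ j, ρ j ≤ 1 / 2)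
    (hϑ0 : 0 < ϑ) (hϑ1 : ϑ < 1) (hrate : ∀ j, ρ j ≤ c₁ * ϑ ^ j) :
    ∃ a : ℕ → ℕ → ℝ, (∀ K j, a K j ∈ Icc ((1 - κ j) * θ j) (θ j)) ∧
      ShellWeightBound l₀ (fun K => (Finset.univ : Finset (Fin (n K) → Bool)).map
          ⟨fun (τ' : Fin (n K) → Bool) (j : ℕ) => if h : j < n K then τ' ⟨j, h⟩ else false, ext_injective (n := n K)⟩)
        (fun K t τ => histWeight (modelAWeightW ((Γ0A K).withDensity fun ω => ENNReal.ofReal (Real.exp (t * prodObs (D.scheme g₀) (K₀ + K) os (πA K ω))))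
            (W K) (live K) (fun i => uA K i.1) (fun i => a K (lvl K i.1)) (fun i => τ i.1))
          ((liveSmallW (W K) (live K) fun i => τ i.1).map Fin.valEmbedding) (uA K) (fun s => a K (lvl K s)))
        (fun K t τ => histWeight (modelAWeightW ((Γ0B K).withDensity fun ω => ENNReal.ofReal (Real.exp (t * prodObs (D.scheme g₀) (K₀ + K + 1) os (πB K ω))))
            (W K) (live K) (fun i => uB K i.1) (fun i => a K (lvl K i.1)) (fun i => τ i.1))
          ((liveSmallW (W K) (live K) fun i => τ i.1).map Fin.valEmbedding) (uB K) (fun s => a K (lvl K s)))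
        (fun K t τ => histShell (modelAWeightW ((Γ0A K).withDensity fun ω => ENNReal.ofReal (Real.exp (t * prodObs (D.scheme g₀) (K₀ + K) os (πA K ω))))
            (W K) (live K) (fun i => uA K i.1) (fun i => a K (lvl K i.1)) (fun i => τ i.1))
          ((liveSmallW (W K) (live K) fun i => τ i.1).map Fin.valEmbedding) (uA K) (uB K) (fun s => a K (lvl K s)))
        (fun K t τ => histShell (modelAWeightW ((Γ0B K).withDensity fun ω => ENNReal.ofReal (Real.exp (t * prodObs (D.scheme g₀) (K₀ + K + 1) os (πB K ω))))
            (W K) (live K) (fun i => uB K i.1) (fun i => a K (lvl K i.1)) (fun i => τ i.1))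
          ((liveSmallW (W K) (live K) fun i => τ i.1).map Fin.valEmbedding) (uB K) (uA K) (fun s => a K (lvl K s)))
        fun K => (2 * ((N₁ + 1) * νbar * (Real.exp l₀ / (Real.exp l₀)⁻¹ * (2 * (2 * νbar) / κmin)) * c₁ * ϑ⁻¹ ^ N₁)) * ϑ ^ K :=
  shellWeightBound_histories_modelAW_window D g₀ os K₀ n W live nbhd lvl uA uB hM hπA hπB huA huB
    (fun K τ τ' i h => live_causal_of_shadow (live K) (shadow K) (hlive K) (hlt K) τ τ' i h)
    (fun K τ' s hs => nbhd_subset_liveSmall (live K) (shadow K) (hlive K) (hher K) (nbhd K) (hnb K) (W K) τ' s hs)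
    hdetA hdetB hθ hκ hρ hwin hΔ hκmin hκminle hρhalf hϑ0 hϑ1 hrate

end EndToEnd

end Summit.QuantumFields.YangMills.Theorems.N21HistoriesShadowLiveness

end
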